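import Summits.Ventures.Crystal3D.Bulk.LinkCharts
import Mathlib.LinearAlgebra.Matrix.DotProduct
import HarnessLib

/-!
# The placement chart of the famcert lineage in the kernel: AZI / ROT / TRI as coded in
# `famcert2-v3.c`, the two-circle existence test, `det = β (1 − G²)`, TRI non-degeneracy from the
# rows, and the mirror — the geometric core of the famcert premise "the chart is exhaustive"

HONEST FRAMING. Part of the venture `Summits/Ventures/Crystal3D` (cell `pub-crystal3d`, phase 2;
seat p2, PROMOTION-AUDIT prep). Elementary linear algebra in `ℝ³` (vectors `Fin 3 → ℝ`, `⬝ᵥ`,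
Mathlib's `⨯₃`), on top of `Bulk/LinkCharts.lean` (the LINK lineage's charts); nothing here asserts
anything about GAP(1.26), books or replays a kill, or moves a census number. Purpose: the famcert
lineage (engine-2's `famcert2.c` v2/v3/v4, sha256:16 `e5f7cec0b848bd5f` for v3, replayed by
engine-1's `lfreplay`; the «E2-famcert» / «E2-famcert3-frame» bookings of CANDIDATE #6) PLACES the
shell directions `x_v` (`v ≠ p`; `p = e₃`) of an item one at a time by the program of
`FAMCERT-PRODUCER-AUDIT-DOSSIER-engine2-g11.md` §1 (code `build()`/`place()`, l.139–203):
gauge `h₁ = (s, 0, c)`, `s = √(1 − c²)`; **AZI**(v ∼ p): `x_v = (s cos θ, s sin θ, c)`;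
**ROT**(v; a): `x_v = c_a x_a + s_a (cos θ · e₁ + sin θ · e₂)`, `e₁ = (x_a × p)/|x_a × p| =
(a_y, −a_x, 0)/√(a_x² + a_y²)`, `e₂ = x_a × e₁`; **TRI**(v; a → b): `G = x_a·x_b`,
`α = (c_a − c_b G)/(1 − G²)`, `γ = (c_b − c_a G)/(1 − G²)`, `rad = (1 − (α c_a + γ c_b))/(1 − G²)`,
`β = ±√rad`, `x_v = α x_a + γ x_b + β (x_a × x_b)` — targets `c_u ∈ {1/2, c}`. The dossier's §1
(X0)–(X7) is the producer's proof that the chart is EXHAUSTIVE; THIS file proves its geometric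
steps (X0)–(X3) and (X6) as kernel theorems, exactly in the code's coordinates:

* **`famcert_gauge`** (X0) with `famcert_rotZ_dot` / `famcert_rotZ_cross` / `famcert_rotZ_triple` /
  `famcert_rotZ_e3`: a rotation about `p` carries the first hole partner `h₁` (`h₁·p = c`, `c² < 1`)
  to the gauge point `(√(1 − c²), 0, c)` and preserves `p`, every dot product and every triple
  product — the gauged configuration satisfies the same rows (E)(S)(C);
* **`famcert_AZI_chart`** (X1): a unit `X` with `X_z = c`, `c² < 1`, is `(s cos θ, s sin θ, c)`;
* **`famcert_ROT_frame`**, **`famcert_ROT_chart`** (X2): for a unit anchor `a` with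
  `0 < a_x² + a_y²` (i.e. `a ≠ ±p` — the one chart singularity, (X5)), `e₁ = (a_y, −a_x, 0)/√(a_x² + a_y²)`
  is a unit vector `⊥ a` and every unit `X` with `X·a = κ`, `κ² < 1`, is
  `κ a + √(1 − κ²)(cos θ · e₁ + sin θ · (a × e₁))` for some `θ`;
* **`famcert_TRI_chart`** (X3): unit anchors `a, b` with `G² < 1`, a unit `X` with `X·a = κ₁`,
  `X·b = κ₂` ⇒ `X = α a + γ b + β (a × b)` with the code's `α, γ` and `β² = rad` AS CODED
  (`(1 − (α κ₁ + γ κ₂))/(1 − G²)`), and **`famcert_TRI_det`**: `X·(a × b) = det[X, a, b] = β (1 − G²)`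
  — so the sign of `β` IS the sign of the corner row (C) `det[x_v, x_a, x_b] ≥ 0`;
* **`famcert_twoCircle_test`** (the existence test l.192): such an `X` forces
  `(G − κ₁κ₂)² ≤ (1 − κ₁²)(1 − κ₂²)`, i.e. `κ₁κ₂ − s₁s₂ ≤ G ≤ κ₁κ₂ + s₁s₂` — a box where `G` is
  certainly outside is correctly killed (`RADNEG`);
* **`famcert_TRI_nondegenerate`** (X3's "x_a ≠ ±x_b"): unit `a, b` with `a·b < 1` (a row:
  `≤ 1/2` or `≤ c < 1`) and a common unit neighbour `X` with `X·a + X·b ≠ 0` (targets are `1/2`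
  or `c = cos t > 0`) have `G² < 1`;
* **`famcert_mirror_dot`**, **`famcert_mirror_cross`**, **`famcert_mirror_triple`** (X6): the
  reflection `(x, y, z) ↦ (x, −y, z)` fixes `p` and the gauge point, preserves every dot product and
  negates every triple product — one run covers "M or its mirror".

What stays OUTSIDE the kernel (as for (S_LINK) in `Bulk/LinkCharts.lean`): the plan bookkeeping
(which step type the greedy `build()` picks; that every `x_v`, `v ≠ p`, gets a step), both signs
enumerated at TRI? steps (X4), the entire-enclosure semantics at the singularity `a = ±p` (X5), the
angle domain `(−π, π] ⊆ [−up(M), up(M)]` (X7), the interval arithmetic, and the identification of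
the key's rooted oriented map with a configuration's tight map (the enumeration premise shared by
every instrument).

References: engine-2, `pub-crystal3d-engine-2/famcert/audit-prep-g11/FAMCERT-PRODUCER-AUDIT-DOSSIER-engine2-g11.md`
§1–§2 (r4 `05e176875e97e3e8`); engine-1, `README-LFREPLAY.md` (premise (S)).
-/

noncomputable section

namespace Summit.Ventures.Crystal3D

open Matrix

section Famcert

/-! ## (X1) AZI -/

/-- **famcert's AZI step is exhaustive** (`place()`, `st.type == 3`, l.184:
`X[v] = (Ss·ct, Ss·sn, Cc)`): a unit `X` at level `X_z = c` from `p = e₃` with `c² < 1` is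
`(√(1 − c²) cos θ, √(1 − c²) sin θ, c)` for some `θ`. [folklore] -/
theorem famcert_AZI_chart {X : Fin 3 → ℝ} {c : ℝ} (hc : c ^ 2 < 1) (hXz : X 2 = c)
    (hX : X ⬝ᵥ X = 1) :
    ∃ θ : ℝ, X = ![Real.sqrt (1 - c ^ 2) * Real.cos θ, Real.sqrt (1 - c ^ 2) * Real.sin θ, c] := by
  obtain ⟨φ, hφ⟩ := link_HA_chart hc hXz hX
  refine ⟨φ, ?_⟩
  rw [hφ]
  ext i; fin_cases i <;> simp [mul_comm]

/-! ## (X2) ROT -/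

/-- **famcert's ROT frame** (l.185–186: `nrm2 = A.x² + A.y²`, `e1 = (A.y, −A.x, 0)/√nrm2`,
`e2 = A × e1`): for a unit anchor `a` with `0 < a_x² + a_y²`, `e₁ = (a_y, −a_x, 0)/√(a_x² + a_y²)`
is a unit vector orthogonal to `a` (and `e₁ = (a × p)/|a × p|`, `p = e₃`). [folklore] -/
theorem famcert_ROT_frame {a : Fin 3 → ℝ} (hn : 0 < a 0 ^ 2 + a 1 ^ 2) :
    ((Real.sqrt (a 0 ^ 2 + a 1 ^ 2))⁻¹ • ![a 1, -(a 0), 0]) ⬝ᵥ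
        ((Real.sqrt (a 0 ^ 2 + a 1 ^ 2))⁻¹ • ![a 1, -(a 0), 0]) = 1 ∧
      ((Real.sqrt (a 0 ^ 2 + a 1 ^ 2))⁻¹ • ![a 1, -(a 0), 0]) ⬝ᵥ a = 0 ∧
      a ⨯₃ ![(0:ℝ), 0, 1] = ![a 1, -(a 0), 0] := by
  set q := Real.sqrt (a 0 ^ 2 + a 1 ^ 2) with hq
  have hq2 : q ^ 2 = a 0 ^ 2 + a 1 ^ 2 := Real.sq_sqrt hn.le
  have hq0 : q ≠ 0 := (Real.sqrt_pos.2 hn).ne'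
  refine ⟨?_, ?_, ?_⟩
  · simp only [smul_dotProduct, dotProduct_smul, smul_eq_mul, vec3_dotProduct]
    simp only [Matrix.cons_val_zero, Matrix.cons_val_one, Matrix.cons_val]
    field_simp
    nlinarith [hq2]
  · simp only [smul_dotProduct, smul_eq_mul, vec3_dotProduct]
    simp only [Matrix.cons_val_zero, Matrix.cons_val_one, Matrix.cons_val]
    ring
  · rw [cross_apply]; simp

/-- **famcert's ROT step is exhaustive** (`st.type == 4`, l.185–188:
`X[v] = ca·A + sa·(ct·e1 + sn·e2)`, `sa = √(1 − ca²)`, `e2 = A × e1`): for a unit anchor `a` with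
`0 < a_x² + a_y²` and a unit `X` with `X·a = κ`, `κ² < 1` (`κ = 1/2`, or `c` when `a` is at the
hole level), `X = κ a + √(1 − κ²)(cos θ · e₁ + sin θ · (a × e₁))` for some `θ`, with famcert's
`e₁ = (a_y, −a_x, 0)/√(a_x² + a_y²)` — the full circle of `θ` covers every solution. [folklore] -/
theorem famcert_ROT_chart {a X : Fin 3 → ℝ} (ha : a ⬝ᵥ a = 1) (hn : 0 < a 0 ^ 2 + a 1 ^ 2)
    {κ : ℝ} (hκ : κ ^ 2 < 1) (hX : X ⬝ᵥ X = 1) (hXa : X ⬝ᵥ a = κ) :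
    ∃ θ : ℝ, X = κ • a + Real.sqrt (1 - κ ^ 2) •
      (Real.cos θ • ((Real.sqrt (a 0 ^ 2 + a 1 ^ 2))⁻¹ • ![a 1, -(a 0), 0]) +
        Real.sin θ • (a ⨯₃ ((Real.sqrt (a 0 ^ 2 + a 1 ^ 2))⁻¹ • ![a 1, -(a 0), 0]))) := by
  obtain ⟨h1, h2, -⟩ := famcert_ROT_frame hn
  exact oneAnchor_chart ha h1 h2 hκ hX hXa

/-! ## (X3) TRI -/

/-- **famcert's TRI step is exhaustive, with `rad` AS CODED** (l.189–199: `G = A·B`,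
`iden = 1/(1 − G²)`, `al = (ca − cb·G)·iden`, `ga = (cb − ca·G)·iden`,
`rad = (1 − (al·ca + ga·cb))·iden`, `be = ±√rad`, `X[v] = al·A + ga·B + be·(A × B)`): unit anchors
`a, b` with `G = a·b`, `G² < 1`, and a unit `X` with `X·a = κ₁`, `X·b = κ₂`; then
`X = α a + γ b + β (a × b)` for some real `β` with `β² = (1 − (α κ₁ + γ κ₂))/(1 − G²)` — both signs of
`β` (the TRI? branches, or the sign fixed by the corner row via `famcert_TRI_det`) cover every
solution. [folklore] -/
theorem famcert_TRI_chart {a b X : Fin 3 → ℝ} (ha : a ⬝ᵥ a = 1) (hb : b ⬝ᵥ b = 1)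
    (hG : (a ⬝ᵥ b) ^ 2 < 1) {κ₁ κ₂ : ℝ} (h1 : X ⬝ᵥ a = κ₁) (h2 : X ⬝ᵥ b = κ₂)
    (hX : X ⬝ᵥ X = 1) :
    ∃ β : ℝ,
      X = ((κ₁ - κ₂ * (a ⬝ᵥ b)) / (1 - (a ⬝ᵥ b) ^ 2)) • a +
          ((κ₂ - κ₁ * (a ⬝ᵥ b)) / (1 - (a ⬝ᵥ b) ^ 2)) • b + β • (a ⨯₃ b) ∧
      β ^ 2 = (1 - (((κ₁ - κ₂ * (a ⬝ᵥ b)) / (1 - (a ⬝ᵥ b) ^ 2)) * κ₁ +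
          ((κ₂ - κ₁ * (a ⬝ᵥ b)) / (1 - (a ⬝ᵥ b) ^ 2)) * κ₂)) / (1 - (a ⬝ᵥ b) ^ 2) := by
  obtain ⟨C, hXeq, hC⟩ := twoAnchor_chart ha hb hG h1 h2 hX
  set g := a ⬝ᵥ b with hg
  have hden : 1 - g ^ 2 ≠ 0 := by
    have : 0 < 1 - g ^ 2 := by linarith
    exact this.ne'
  have e1 : (κ₁ - κ₂ * g) / (1 - g ^ 2) = (κ₁ - g * κ₂) / (1 - g ^ 2) := by ring
  have e2 : (κ₂ - κ₁ * g) / (1 - g ^ 2) = (κ₂ - g * κ₁) / (1 - g ^ 2) := by ring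
  refine ⟨C, ?_, ?_⟩
  · rw [e1, e2]; exact hXeq
  · rw [e1, e2, eq_div_iff hden, hC]
    field_simp
    ring

/-- **`det[x_v, x_a, x_b] = β (1 − G²)`** (dossier §1 (X3)): for unit `a, b` and ANY
`X = α a + γ b + β (a × b)`, the triple product `X·(a × b)` — which is the determinant
`det[X, a, b]` (Mathlib `triple_product_eq_det`) of the corner row (C) — equals `β (1 − (a·b)²)`.
Hence with `G² < 1`: `det ≥ 0 ↔ β ≥ 0`, the sign famcert fixes at a TRI step. [folklore] -/
theorem famcert_TRI_det {a b : Fin 3 → ℝ} (ha : a ⬝ᵥ a = 1) (hb : b ⬝ᵥ b = 1) (α γ β : ℝ) :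
    (α • a + γ • b + β • (a ⨯₃ b)) ⬝ᵥ (a ⨯₃ b) = β * (1 - (a ⬝ᵥ b) ^ 2) ∧
      Matrix.det ![α • a + γ • b + β • (a ⨯₃ b), a, b] = β * (1 - (a ⬝ᵥ b) ^ 2) := by
  have hba : b ⬝ᵥ a = a ⬝ᵥ b := dotProduct_comm _ _
  have h : (α • a + γ • b + β • (a ⨯₃ b)) ⬝ᵥ (a ⨯₃ b) = β * (1 - (a ⬝ᵥ b) ^ 2) := by
    rw [add_dotProduct, add_dotProduct, smul_dotProduct, smul_dotProduct, smul_dotProduct,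
      dot_self_cross, dot_cross_self, cross_dot_cross, ha, hb, hba]
    simp only [smul_eq_mul]; ring
  exact ⟨h, by rw [← triple_product_eq_det]; exact h⟩

/-- **The sign of `β` is the sign of the corner determinant** (consequence of `famcert_TRI_det`
for `G² < 1`): `0 ≤ det[X, a, b] ↔ 0 ≤ β`. [folklore] -/
theorem famcert_TRI_sign {a b : Fin 3 → ℝ} (ha : a ⬝ᵥ a = 1) (hb : b ⬝ᵥ b = 1)
    (hG : (a ⬝ᵥ b) ^ 2 < 1) (α γ β : ℝ) :
    0 ≤ Matrix.det ![α • a + γ • b + β • (a ⨯₃ b), a, b] ↔ 0 ≤ β := by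
  rw [(famcert_TRI_det ha hb α γ β).2]
  have h1 : 0 < 1 - (a ⬝ᵥ b) ^ 2 := by linarith
  constructor
  · intro h; nlinarith
  · intro h; exact mul_nonneg h h1.le

/-- **famcert's two-circle existence test** (l.192: kill the box when `G` is certainly outside
`[ca·cb − sa·sb, ca·cb + sa·sb]`): if a unit `X` has `X·a = κ₁`, `X·b = κ₂` for unit `a, b` with
`G = a·b`, `G² < 1`, then `(G − κ₁κ₂)² ≤ (1 − κ₁²)(1 − κ₂²)` (the spherical triangle inequality;
`= β²(1 − G²)²  ≥ 0` by the chart). [folklore] -/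
theorem famcert_twoCircle_test {a b X : Fin 3 → ℝ} (ha : a ⬝ᵥ a = 1) (hb : b ⬝ᵥ b = 1)
    (hG : (a ⬝ᵥ b) ^ 2 < 1) {κ₁ κ₂ : ℝ} (h1 : X ⬝ᵥ a = κ₁) (h2 : X ⬝ᵥ b = κ₂)
    (hX : X ⬝ᵥ X = 1) :
    (a ⬝ᵥ b - κ₁ * κ₂) ^ 2 ≤ (1 - κ₁ ^ 2) * (1 - κ₂ ^ 2) := by
  obtain ⟨C, -, hC⟩ := twoAnchor_chart ha hb hG h1 h2 hX
  set g := a ⬝ᵥ b with hg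
  have h0 : 0 < 1 - g ^ 2 := by linarith
  have hden : 1 - g ^ 2 ≠ 0 := h0.ne'
  -- `C² (1 − g²)² = (1 − κ₁²)(1 − κ₂²) − (g − κ₁κ₂)²`
  have key : C ^ 2 * (1 - g ^ 2) * (1 - g ^ 2) = (1 - κ₁ ^ 2) * (1 - κ₂ ^ 2) - (g - κ₁ * κ₂) ^ 2 := by
    rw [hC]; field_simp; ring
  nlinarith [mul_nonneg (mul_nonneg (sq_nonneg C) h0.le) h0.le]

/-- The same test with square roots, in the code's form
`κ₁κ₂ − √(1 − κ₁²) √(1 − κ₂²) ≤ G ≤ κ₁κ₂ + √(1 − κ₁²) √(1 − κ₂²)` (`κ₁² ≤ 1`). [folklore] -/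
theorem famcert_twoCircle_test' {a b X : Fin 3 → ℝ} (ha : a ⬝ᵥ a = 1) (hb : b ⬝ᵥ b = 1)
    (hG : (a ⬝ᵥ b) ^ 2 < 1) {κ₁ κ₂ : ℝ} (hκ₁ : κ₁ ^ 2 ≤ 1)
    (h1 : X ⬝ᵥ a = κ₁) (h2 : X ⬝ᵥ b = κ₂) (hX : X ⬝ᵥ X = 1) :
    κ₁ * κ₂ - Real.sqrt (1 - κ₁ ^ 2) * Real.sqrt (1 - κ₂ ^ 2) ≤ a ⬝ᵥ b ∧
      a ⬝ᵥ b ≤ κ₁ * κ₂ + Real.sqrt (1 - κ₁ ^ 2) * Real.sqrt (1 - κ₂ ^ 2) := by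
  have h := famcert_twoCircle_test ha hb hG h1 h2 hX
  have hs : Real.sqrt (1 - κ₁ ^ 2) * Real.sqrt (1 - κ₂ ^ 2) =
      Real.sqrt ((1 - κ₁ ^ 2) * (1 - κ₂ ^ 2)) := (Real.sqrt_mul (by linarith) _).symm
  have hab : |a ⬝ᵥ b - κ₁ * κ₂| ≤ Real.sqrt ((1 - κ₁ ^ 2) * (1 - κ₂ ^ 2)) :=
    Real.abs_le_sqrt h
  rw [hs]
  constructor <;> [have := (abs_le.1 hab).1; have := (abs_le.1 hab).2] <;> linarith

/-- **TRI non-degeneracy from the rows** (dossier §1 (X3): "x_a ≠ ±x_b"): unit anchors `a, b`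
with `a·b < 1` (a shell–shell pair has `a·b ≤ 1/2` by (E)/(S), a pair with the hole partner level
`≤ c < 1`) and a common unit neighbour `X` whose two targets do not cancel (`X·a + X·b ≠ 0`; the
targets are `1/2` or `c = cos t > 0`) satisfy `G² < 1`, so `{a, b, a × b}` is a basis. [folklore] -/
theorem famcert_TRI_nondegenerate {a b X : Fin 3 → ℝ} (ha : a ⬝ᵥ a = 1) (hb : b ⬝ᵥ b = 1)
    (hlt : a ⬝ᵥ b < 1) (hsum : X ⬝ᵥ a + X ⬝ᵥ b ≠ 0) : (a ⬝ᵥ b) ^ 2 < 1 := by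
  have hba : b ⬝ᵥ a = a ⬝ᵥ b := dotProduct_comm _ _
  have hnn : 0 ≤ (a + b) ⬝ᵥ (a + b) :=
    Finset.sum_nonneg fun i _ => mul_self_nonneg _
  have hexp : (a + b) ⬝ᵥ (a + b) = 2 + 2 * (a ⬝ᵥ b) := by
    rw [add_dotProduct, dotProduct_add, dotProduct_add, ha, hb, hba]; ring
  have hge : -1 ≤ a ⬝ᵥ b := by linarith
  have hne : a ⬝ᵥ b ≠ -1 := by
    intro h
    have h0 : (a + b) ⬝ᵥ (a + b) = 0 := by rw [hexp, h]; ring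
    have hab : a + b = 0 := dotProduct_self_eq_zero.1 h0
    apply hsum
    rw [← dotProduct_add, hab, dotProduct_zero]
  have hgt : -1 < a ⬝ᵥ b := lt_of_le_of_ne hge (Ne.symm hne)
  nlinarith


/-! ## (X0) The gauge: a rotation about `p` puts `h₁` at `(s, 0, c)` and changes no row

No `def` is introduced (so that the file stays theorem-only): the rotation by `φ` about `p = e₃` is
written out as `R_φ u = (cos φ · u₀ − sin φ · u₁, sin φ · u₀ + cos φ · u₁, u₂)` in every statement. -/

/-- The rotation about `p` fixes `p = e₃`. [folklore] -/
theorem famcert_rotZ_e3 (φ : ℝ) :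
    (![Real.cos φ * (![0, 0, 1] : Fin 3 → ℝ) 0 - Real.sin φ * (![0, 0, 1] : Fin 3 → ℝ) 1,
        Real.sin φ * (![0, 0, 1] : Fin 3 → ℝ) 0 + Real.cos φ * (![0, 0, 1] : Fin 3 → ℝ) 1,
        (![0, 0, 1] : Fin 3 → ℝ) 2] : Fin 3 → ℝ) = ![0, 0, 1] := by
  ext i; fin_cases i <;> simp

/-- **The rotation about `p` preserves every dot product** (rows (E)(S) invariant). [folklore] -/
theorem famcert_rotZ_dot (φ : ℝ) (u v : Fin 3 → ℝ) :
    (![Real.cos φ * u 0 - Real.sin φ * u 1, Real.sin φ * u 0 + Real.cos φ * u 1, u 2] : Fin 3 → ℝ)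
        ⬝ᵥ ![Real.cos φ * v 0 - Real.sin φ * v 1, Real.sin φ * v 0 + Real.cos φ * v 1, v 2] =
      u ⬝ᵥ v := by
  simp only [vec3_dotProduct]
  simp only [Matrix.cons_val_zero, Matrix.cons_val_one, Matrix.cons_val]
  have h := Real.sin_sq_add_cos_sq φ
  linear_combination (u 0 * v 0 + u 1 * v 1) * h

/-- **The rotation about `p` is proper**: it commutes with the cross product. [folklore] -/
theorem famcert_rotZ_cross (φ : ℝ) (u v : Fin 3 → ℝ) :
    (![Real.cos φ * u 0 - Real.sin φ * u 1, Real.sin φ * u 0 + Real.cos φ * u 1, u 2] : Fin 3 → ℝ)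
        ⨯₃ ![Real.cos φ * v 0 - Real.sin φ * v 1, Real.sin φ * v 0 + Real.cos φ * v 1, v 2] =
      ![Real.cos φ * (u ⨯₃ v) 0 - Real.sin φ * (u ⨯₃ v) 1,
        Real.sin φ * (u ⨯₃ v) 0 + Real.cos φ * (u ⨯₃ v) 1, (u ⨯₃ v) 2] := by
  have h := Real.sin_sq_add_cos_sq φ
  simp only [cross_apply]
  ext i; fin_cases i
  · simp; ring
  · simp; ring
  · simp; linear_combination (u 0 * v 1 - u 1 * v 0) * h

/-- **Triple products `det[x_v, x_a, x_b]` are invariant under the rotation about `p`** (rows (C)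
invariant). [folklore] -/
theorem famcert_rotZ_triple (φ : ℝ) (X a b : Fin 3 → ℝ) :
    (![Real.cos φ * X 0 - Real.sin φ * X 1, Real.sin φ * X 0 + Real.cos φ * X 1, X 2] : Fin 3 → ℝ)
        ⬝ᵥ ((![Real.cos φ * a 0 - Real.sin φ * a 1, Real.sin φ * a 0 + Real.cos φ * a 1, a 2] :
              Fin 3 → ℝ) ⨯₃
            ![Real.cos φ * b 0 - Real.sin φ * b 1, Real.sin φ * b 0 + Real.cos φ * b 1, b 2]) =
      X ⬝ᵥ (a ⨯₃ b) := by
  rw [famcert_rotZ_cross, famcert_rotZ_dot]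

/-- **famcert's gauge exists** (`build()` l.143 / `place()` l.183: `X[h1] = (Ss, 0, Cc)`): a unit
`h` at the hole level `h_z = c`, `c² < 1`, is carried by some rotation about `p` to the gauge point
`(√(1 − c²), 0, c)`; by `famcert_rotZ_dot` / `famcert_rotZ_triple` / `famcert_rotZ_e3` the rotated
configuration satisfies the same rows (E)(S)(C) with the same `p`. [folklore] -/
theorem famcert_gauge {h : Fin 3 → ℝ} {c : ℝ} (hc : c ^ 2 < 1) (hz : h 2 = c) (hh : h ⬝ᵥ h = 1) :
    ∃ φ : ℝ, (![Real.cos φ * h 0 - Real.sin φ * h 1, Real.sin φ * h 0 + Real.cos φ * h 1, h 2] :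
      Fin 3 → ℝ) = ![Real.sqrt (1 - c ^ 2), 0, c] := by
  obtain ⟨θ, hθ⟩ := famcert_AZI_chart hc hz hh
  refine ⟨-θ, ?_⟩
  have k := Real.sin_sq_add_cos_sq θ
  rw [hθ]
  ext i; fin_cases i
  · simp [Real.cos_neg, Real.sin_neg]
    linear_combination Real.sqrt (1 - c ^ 2) * k
  · simp [Real.cos_neg, Real.sin_neg]; ring
  · simp

/-! ## (X6) The mirror `(x, y, z) ↦ (x, −y, z)` (written out; no `def`) -/

/-- The mirror fixes the hole direction `p = e₃` and every gauge point `(s, 0, c)`. [folklore] -/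
theorem famcert_mirror_gauge (s c : ℝ) :
    (![(![0, 0, 1] : Fin 3 → ℝ) 0, -((![0, 0, 1] : Fin 3 → ℝ) 1), (![0, 0, 1] : Fin 3 → ℝ) 2] :
        Fin 3 → ℝ) = ![0, 0, 1] ∧
      (![(![s, 0, c] : Fin 3 → ℝ) 0, -((![s, 0, c] : Fin 3 → ℝ) 1), (![s, 0, c] : Fin 3 → ℝ) 2] :
        Fin 3 → ℝ) = ![s, 0, c] := by
  constructor <;> (ext i; fin_cases i <;> simp)

/-- **The mirror preserves every dot product** (all rows (E)(S) are invariant). [folklore] -/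
theorem famcert_mirror_dot (u v : Fin 3 → ℝ) :
    (![u 0, -(u 1), u 2] : Fin 3 → ℝ) ⬝ᵥ ![v 0, -(v 1), v 2] = u ⬝ᵥ v := by
  simp only [vec3_dotProduct]
  simp only [Matrix.cons_val_zero, Matrix.cons_val_one, Matrix.cons_val]
  ring

/-- **The mirror reverses cross products up to the mirror**: `M u × M v = −M (u × v)` (an improper
orthogonal map). [folklore] -/
theorem famcert_mirror_cross (u v : Fin 3 → ℝ) :
    (![u 0, -(u 1), u 2] : Fin 3 → ℝ) ⨯₃ ![v 0, -(v 1), v 2] =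
      -![(u ⨯₃ v) 0, -((u ⨯₃ v) 1), (u ⨯₃ v) 2] := by
  simp only [cross_apply]
  ext i; fin_cases i <;> simp <;> ring

/-- **The mirror negates every triple product** `det[x_v, x_a, x_b]` (all rows (C) flip, so a
configuration with the reversed rotation sense at every vertex maps to one with the key's sense:
one run covers "M or its mirror"). [folklore] -/
theorem famcert_mirror_triple (X a b : Fin 3 → ℝ) :
    (![X 0, -(X 1), X 2] : Fin 3 → ℝ) ⬝ᵥ ((![a 0, -(a 1), a 2] : Fin 3 → ℝ) ⨯₃ ![b 0, -(b 1), b 2]) =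
      -(X ⬝ᵥ (a ⨯₃ b)) := by
  rw [famcert_mirror_cross, dotProduct_neg, famcert_mirror_dot]

end Famcert

end Summit.Ventures.Crystal3D
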